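import Summits.PneNP.PneNP.Theorems.ChebyshevTracialDesignGammaDirectionNumericsA
import Summits.PneNP.PneNP.Theorems.ChebyshevTracialDesignGammaDirectionBulkNumerics
import Summits.PneNP.PneNP.Theorems.ChebyshevTracialDesignLqConstantsScale
import Literature.Combinatorics.Optimization.ShellLawLineSection
import HarnessLib

/-!
# Cell pnp-psdrank, route `ChebyshevTracialDesign`: ALL the real-number hypotheses of brick 142 (`gammaDirection_value_le_discharged`) at once,
# for `N₀^{1/8} ≥ P*` (crux `TracialDecayExp20`, stmt-PneNP-19878)

Brick 143a (eng g26; prover MEMO-31 §6 «recipe for brick 143»). Brick 142 (`…GammaDirectionDischarged.gammaDirection_value_le_discharged`, prover g28)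
bounds the γ-direction design value of an `H`-symmetric mask at a perfect matching by pure remainders plus the law's off-window tail, conditional on a long
list of REAL inequalities between the edge numbers `N₀ ⊇ N₁ ⊇ N₂`, the cut `2s+1 = 2r+7`, the design degree `D`, the window `ε`, a free length `L` (and the
`k = 1` leg's `Lx, E, Far`), Lq's constants `(Γ, q)`, the variance floor `cV`, the window floor `LB`, and three smallness conditions `ε_A ≤ ¾`, `ε_B ≤ ¼`,
`ε_C ≤ ¼`. This file discharges ALL of them at once for `P = N₀^{1/8} ≥ P*(β, K)`:
* **`gamma_numerics`**: for `0 < β ≤ 1/5`, `K ≥ 0` there is `P* ≥ 0` such that for every `(n N₀ N₁ N₂ D a s r : ℕ)` with `N₁+1 = N₀`, `N₂+1 = N₁`,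
  `r+3 = s`, `n = 2N₀`, `P* ≤ N₀^{1/8}`, `1 ≤ D`, `D⁴ ≤ 2N₀`, `a ≤ N₀`, the design's balance `n ≤ 4(2s+1)` and `2(2s+1)+2 ≤ n`, every window
  `0 ≤ ε ≤ K√(2N₀D)` and every `LB ≥ e^{−64(ε+11)²/(β⁵N₀)}/(128N₀²)` (lit g39's a-free window floor), there are `L, E, Far, Γ, q, cV` satisfying
  brick 142's hypotheses `hDN … hεC` VERBATIM with `Lx := L` (listed in that order), plus the cut facts `βN₂+D+2 ≤ s`, `8s ≤ (4+β)(N₀−2D)`,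
  `2s+2D+2 ≤ n`, the variance-floor data `cV = (√2(β/32)P⁴)²/2` with lit's smallness `256(√2(β/32)P⁴+2)²+3ε+3 ≤ β²N₀`
  (`centredSq_law_ge_of_typeMargins'`), and the window-floor smallness `4ε+36 ≤ β³N₀` (`shellLaw_one_window_lower_afree_cell`).
  CHOICES: `L = 2D + √(4N₀R)`, `R = E₀ + log 256 + 6 log N₀ + D`, `E₀ = (64/β)(ε+11)²/(β⁴(N₀−1))` (brick 140c `gamma_bulk_numerics` with
  `C₁ = 64/β, C₂ = 10, C₃ = 128`, so that its far-term reference `e^{−E₀}/(128N₀²)` is below the a-free `LB`); `Lx := L` (the `k = 1` margins then follow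
  from the Lq margins at `N₂` since `D ≥ 1`); `E := c_E/P⁵` (`xSmoothConst_le`), `Far := 4e^{−(L−2)²/(4(N₀−2))} ≤ 4τ`, `τ = e^{−(L−2D)²/(4N₀)}`;
  `Γ := (1+8c_Q/3)P`, `q := 16(c_η+c_Q)²/(3β)/P⁶` (`lqConstants_le` at `N₀, N₁, N₂`); `cV := (β/32)²P⁸` (lit g39); `ε_A ≤ ½ ≤ ¾`, `ε_B, ε_C ≤ ¼`,
  `q ≤ ½` (bricks 140d/140b `epsA_numerics`, `epsBC_numerics_nat` with `c_r = β/32`, `m ≤ a ≤ P⁸`).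
So brick 143 (the exp form) is left with the combinatorics only: the window set `B`, the off-window law tail (`ShellLawTail`), the x-smoothness family `X`
by type (brick 132) and the remainder collapse (134a). Pure real arithmetic; ONE `maxHeartbeats 400000` (the 36-field anonymous constructor measures
≈ 150–200k; ×2 head-room). WHAT THIS FILE DOES NOT DO: anything combinatorial, `TracialDecayExp20`, psd rank of P_PM(K_n), P vs NP.
[cite: RollinRoss2010, §4.1 Thm 4.2 (the variance scale)] [cite: Agarwal2000DifferenceEquations, Remark 1.8.1]
Stature: support/instrument (kernel lane, no defs, axioms standard). Supports stmt-PneNP-19878.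
-/

set_option linter.dupNamespace false -- `Summit.PneNP.PneNP.…`: summit = sub-problem (D-0017)

noncomputable section

namespace Summit.PneNP.PneNP.Theorems.ChebyshevTracialDesignGammaDirectionNumericsAll

open Real
open Literature.Combinatorics.Optimization.ShellStep (typeMargins_smallness_of_scale sqrt_half_sq_radius)
open Summit.PneNP.PneNP.Theorems.ChebyshevTracialDesignBulkScale (scale_facts mul_fourThirds_pow_le_exp)
open Summit.PneNP.PneNP.Theorems.ChebyshevTracialDesignGammaDirectionBulkNumerics (gamma_bulk_numerics)
open Summit.PneNP.PneNP.Theorems.ChebyshevTracialDesignLqConstantsScale (lqConstants_le)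
open Summit.PneNP.PneNP.Theorems.ChebyshevTracialDesignGammaDirectionNumericsA (epsA_numerics xSmoothConst_le epsBC_numerics_nat)

set_option maxHeartbeats 400000 in -- the 36-field anonymous constructor against brick 142's literal hypothesis types: ≈150–200k measured
/-- **All the numerics of the γ-direction, packaged** (conclusion = brick 142's real hypotheses `hDN … hεC`, verbatim and in order, with `Lx := L`,
then `βN₂+D+2 ≤ s`, `8s ≤ (4+β)(N₀−2D)`, `2s+2D+2 ≤ n`, `cV = (√2(β/32)P⁴)²/2`, lit's (V)-smallness, `4ε+36 ≤ β³N₀`).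
[cite: RollinRoss2010, §4.1 Thm 4.2 (the variance scale)] [cite: Agarwal2000DifferenceEquations, Remark 1.8.1] -/
theorem gamma_numerics {β K : ℝ} (hβ : 0 < β) (hβ5 : β ≤ 1 / 5) (hK : 0 ≤ K) :
    ∃ Pstar : ℝ, 0 ≤ Pstar ∧ ∀ (n N₀ N₁ N₂ D a s r : ℕ) (ε LB : ℝ),
      N₁ + 1 = N₀ → N₂ + 1 = N₁ → r + 3 = s → n = 2 * N₀ →
      Pstar ≤ (N₀ : ℝ) ^ ((8 : ℕ) : ℝ)⁻¹ → 1 ≤ D → ((D : ℝ)) ^ 4 ≤ 2 * N₀ → a ≤ N₀ →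
      n ≤ 4 * (2 * s + 1) → 2 * (2 * s + 1) + 2 ≤ n →
      0 ≤ ε → ε ≤ K * Real.sqrt (2 * N₀ * D) →
      Real.exp (-(64 * (ε + 11) ^ 2 / (β ^ 5 * (N₀ : ℝ)))) / (128 * (N₀ : ℝ) ^ 2) ≤ LB →
      ∃ L E Far Γ q cV : ℝ,
      (16 * D + 16 ≤ N₂) ∧
      (2 * (D : ℝ) ≤ L) ∧
      (2 * L ≤ N₂) ∧
      (L + D + (ε + 8 + 14 * D + 1) ≤ β ^ 2 * N₂) ∧
      (L + D + (ε + 8 + 14 * D + 1) + 3 ≤ β * ((N₂ : ℝ) - 2 * D) / 8) ∧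
      (2 * (L + D + 1) ≤ (β ^ 2 / 8) ^ 2 * (β * ((N₂ : ℝ) - 2 * D))) ∧
      (4 ≤ β * ((N₂ : ℝ) - 2 * D)) ∧
      ((D : ℝ) * (1 + 8 * (L + D + 1) / ((β ^ 2 / 8) ^ 4 * (β * ((N₂ : ℝ) - 2 * D)))) ≤
      (β ^ 2 / 8) ^ 4 * (β * ((N₂ : ℝ) - 2 * D))) ∧
      (2 ≤ L) ∧
      (L - 2 ≤ 2 * ((N₀ : ℝ) - 2)) ∧
      (L + 1 + (ε + 15) ≤ β * ((r : ℝ) + 2)) ∧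
      (L + 1 + (ε + 15) + 3 ≤ β * ((N₀ : ℝ) - 2) / 8) ∧
      (2 * (L + 1 + 1) ≤ (β ^ 2 / 8) ^ 2 * (β * ((N₀ : ℝ) - 2))) ∧
      (4 ≤ β * ((N₀ : ℝ) - 2)) ∧
      ((1 : ℝ) * (1 + 8 * (L + 1 + 1) / ((β ^ 2 / 8) ^ 4 * (β * ((N₀ : ℝ) - 2)))) ≤
      (β ^ 2 / 8) ^ 4 * (β * ((N₀ : ℝ) - 2))) ∧
      (0 ≤ E) ∧
      (0 ≤ Far) ∧
      ((((1 + 8 * (L + 1 + 1) / ((β ^ 2 / 8) ^ 4 * (β * ((N₀ : ℝ) - 2)))) *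
            (8 * (L + 1 + 1) / ((β ^ 2 / 8) ^ 4 * (β * ((N₀ : ℝ) - 2))) +
              2 * Real.sqrt 192 * Real.sqrt (2 * (2 * (1 : ℝ) + 1) *
                (1 + 8 * (L + 1 + 1) / ((β ^ 2 / 8) ^ 4 * (β * ((N₀ : ℝ) - 2)))) /
                  ((β ^ 2 / 8) ^ 4 * (β * ((N₀ : ℝ) - 2)))))) ^ (2 * 1) *
          (1 + 4 * (Real.sqrt ((N₀ : ℝ) - 2) + 1) / 3 *
            (2 * Real.sqrt 192 * Real.sqrt (2 * (2 * (1 : ℝ) + 1) *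
              (1 + 8 * (L + 1 + 1) / ((β ^ 2 / 8) ^ 4 * (β * ((N₀ : ℝ) - 2)))) /
                ((β ^ 2 / 8) ^ 4 * (β * ((N₀ : ℝ) - 2))))))) ≤ E) ∧
      ((4 : ℝ) ^ 1 * Real.exp (-((L - 2 * 1) ^ 2 / (4 * ((N₀ : ℝ) - 2)))) ≤ Far) ∧
      ((1 + 4 * (Real.sqrt N₀ + 1) / 3 *
          (2 * Real.sqrt 192 * Real.sqrt (2 * (2 * (D : ℝ) + 1) * (1 + 8 * (L + D + 1) / ((β ^ 2 / 8) ^ 4 * (β * ((N₀ : ℝ) - 2 * D)))) /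
            ((β ^ 2 / 8) ^ 4 * (β * ((N₀ : ℝ) - 2 * D)))))) ≤ Γ) ∧
      ((1 + 4 * (Real.sqrt N₁ + 1) / 3 *
          (2 * Real.sqrt 192 * Real.sqrt (2 * (2 * (D : ℝ) + 1) * (1 + 8 * (L + D + 1) / ((β ^ 2 / 8) ^ 4 * (β * ((N₁ : ℝ) - 2 * D)))) /
            ((β ^ 2 / 8) ^ 4 * (β * ((N₁ : ℝ) - 2 * D)))))) ≤ Γ) ∧
      ((1 + 4 * (Real.sqrt N₂ + 1) / 3 *
          (2 * Real.sqrt 192 * Real.sqrt (2 * (2 * (D : ℝ) + 1) * (1 + 8 * (L + D + 1) / ((β ^ 2 / 8) ^ 4 * (β * ((N₂ : ℝ) - 2 * D)))) /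
            ((β ^ 2 / 8) ^ 4 * (β * ((N₂ : ℝ) - 2 * D)))))) ≤ Γ) ∧
      ((4 * ((1 + 8 * (L + D + 1) / ((β ^ 2 / 8) ^ 4 * (β * ((N₀ : ℝ) - 2 * D)))) *
          (8 * (L + D + 1) / ((β ^ 2 / 8) ^ 4 * (β * ((N₀ : ℝ) - 2 * D))) +
            2 * Real.sqrt 192 * Real.sqrt (2 * (2 * (D : ℝ) + 1) * (1 + 8 * (L + D + 1) / ((β ^ 2 / 8) ^ 4 * (β * ((N₀ : ℝ) - 2 * D)))) /
            ((β ^ 2 / 8) ^ 4 * (β * ((N₀ : ℝ) - 2 * D)))))) ^ 2 / (3 * β)) ≤ q) ∧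
      ((4 * ((1 + 8 * (L + D + 1) / ((β ^ 2 / 8) ^ 4 * (β * ((N₁ : ℝ) - 2 * D)))) *
          (8 * (L + D + 1) / ((β ^ 2 / 8) ^ 4 * (β * ((N₁ : ℝ) - 2 * D))) +
            2 * Real.sqrt 192 * Real.sqrt (2 * (2 * (D : ℝ) + 1) * (1 + 8 * (L + D + 1) / ((β ^ 2 / 8) ^ 4 * (β * ((N₁ : ℝ) - 2 * D)))) /
            ((β ^ 2 / 8) ^ 4 * (β * ((N₁ : ℝ) - 2 * D)))))) ^ 2 / (3 * β)) ≤ q) ∧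
      ((4 * ((1 + 8 * (L + D + 1) / ((β ^ 2 / 8) ^ 4 * (β * ((N₂ : ℝ) - 2 * D)))) *
          (8 * (L + D + 1) / ((β ^ 2 / 8) ^ 4 * (β * ((N₂ : ℝ) - 2 * D))) +
            2 * Real.sqrt 192 * Real.sqrt (2 * (2 * (D : ℝ) + 1) * (1 + 8 * (L + D + 1) / ((β ^ 2 / 8) ^ 4 * (β * ((N₂ : ℝ) - 2 * D)))) /
            ((β ^ 2 / 8) ^ 4 * (β * ((N₂ : ℝ) - 2 * D)))))) ^ 2 / (3 * β)) ≤ q) ∧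
      (q ≤ 1 / 2) ∧
      (0 < cV) ∧
      (((E * ((n : ℝ) * ((n : ℝ) - 2) / ((2 * (r : ℝ) + 6) * ((n : ℝ) - 2 * r - 8))) / 4 + 1 / ((r : ℝ) + 1)) +
          ((E * ((n : ℝ) * ((n : ℝ) - 2) / ((2 * (r : ℝ) + 6) * ((n : ℝ) - 2 * r - 8))) / 4 * (2 * (a : ℝ) ^ 2 / ((r : ℝ) + 1) + (2 * (a : ℝ) + 1) * a / ((r : ℝ) + 2)) +
            (2 * (a : ℝ) + 1) * ((r : ℝ) + 3) / (2 * ((r : ℝ) + 2) * ((r : ℝ) + 1)) *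
              ((a : ℝ) * (4 * Γ * q + (2 + 4 * Γ * q) / (2 * (r : ℝ) + 6))) +
            (a : ℝ) * (2 * (a : ℝ) + r + 3) / (2 * ((r : ℝ) + 2) * ((r : ℝ) + 1)) * (1 + 2 * Γ * q)) +
            (D : ℝ) * (2 * Γ * q ^ 2 * (a : ℝ) ^ 2 + 8 * (D : ℝ) * Γ * q * (a : ℝ) ^ 2 / (2 * (r : ℝ) + 6) +
            32 * (D : ℝ) ^ 2 * Γ * (a : ℝ) ^ 2 / ((2 * (r : ℝ) + 6) * (2 * (r : ℝ) + 4)) +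
            (2 * (a : ℝ) + 1) * a * (Γ * q ^ 2 + 4 * (D : ℝ) * Γ * q / (2 * (r : ℝ) + 6)))) / cV +
          ((((2 * (a : ℝ) + 1) * ((r : ℝ) + 3) / (2 * ((r : ℝ) + 2) * ((r : ℝ) + 1)) * (16 * (a : ℝ) / 3) +
            (a : ℝ) * (2 * (a : ℝ) + r + 3) / (2 * ((r : ℝ) + 2) * ((r : ℝ) + 1)) * (8 / 3)) +
              (D : ℝ) * (4 / 3 : ℝ) ^ D *
            ((a : ℝ) ^ 2 * ((2 * (r : ℝ) + 6) * (2 * (r : ℝ) + 4) / ((n : ℝ) * ((n : ℝ) - 2)) + 8 * (D : ℝ) * (2 * (r : ℝ) + 4) / ((n : ℝ) * ((n : ℝ) - 2)) +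
                32 * (D : ℝ) ^ 2 / ((n : ℝ) * ((n : ℝ) - 2)) + 1) +
              (2 * (a : ℝ) + 1) * a * ((2 * (r : ℝ) + 6 + 4 * D) / (n : ℝ)))) * Real.exp (-((L - 2 * D) ^ 2 / (4 * N₀))) +
            ((((r : ℝ) + 2 + a) ^ 2 + 2 * ((r : ℝ) + 2) ^ 2 / ((r : ℝ) + 1) + (2 * (a : ℝ) + 1)) / 4) * Far) / (LB * cV)) ≤ 3 / 4) ∧
      (∀ m : ℝ, 0 ≤ m → m ≤ a →
      (m * (Γ * (2 * q + 3 * D / s) + 2 * Γ * q) +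
          (D : ℝ) * (4 / 3 : ℝ) ^ D * ((2 * (s : ℝ) / n + 4 * D / n) * ((a : ℝ) * Real.exp (-((L - 2 * D) ^ 2 / (4 * N₀)))) + m * Real.exp (-((L - 2 * D) ^ 2 / (4 * N₀)))) / LB) /
        Real.sqrt cV ≤ 1 / 4) ∧
      ((2 * Γ * q + (D : ℝ) * (4 / 3 : ℝ) ^ D * Real.exp (-((L - 2 * D) ^ 2 / (4 * N₀))) / LB) ≤ 1 / 4) ∧
      (β * N₂ + D + 2 ≤ (s : ℝ)) ∧
      (8 * (s : ℝ) ≤ (4 + β) * ((N₀ : ℝ) - 2 * D)) ∧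
      (2 * (s : ℝ) + 2 * D + 2 ≤ n) ∧
      (cV = (Real.sqrt 2 * (β / 32) * ((N₀ : ℝ) ^ ((8 : ℕ) : ℝ)⁻¹) ^ 4) ^ 2 / 2) ∧
      (256 * (Real.sqrt 2 * (β / 32) * ((N₀ : ℝ) ^ ((8 : ℕ) : ℝ)⁻¹) ^ 4 + 2) ^ 2 + 3 * ε + 3 ≤ β ^ 2 * N₀) ∧
      (4 * ε + 36 ≤ β ^ 3 * N₀) := by
  -- the constants
  have hC₁ : (0 : ℝ) ≤ 64 / β := by positivity
  obtain ⟨P₁, cL, hP₁0, hcL0, hbulk⟩ := gamma_bulk_numerics (β := β) (K := K) (C₁ := 64 / β) (C₂ := 10) (C₃ := 128)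
    hβ hβ5 hK hC₁ (by norm_num) (by norm_num)
  obtain ⟨cη, hcη⟩ : ∃ c : ℝ, c = 32 * cL / ((β ^ 2 / 8) ^ 4 * β) := ⟨_, rfl⟩
  obtain ⟨cQ, hcQ⟩ : ∃ c : ℝ, c = 2 * Real.sqrt 192 * Real.sqrt (80 / ((β ^ 2 / 8) ^ 4 * β)) := ⟨_, rfl⟩
  obtain ⟨cQ', hcQ'⟩ : ∃ c : ℝ, c = 2 * Real.sqrt 192 * Real.sqrt (48 / ((β ^ 2 / 8) ^ 4 * β)) := ⟨_, rfl⟩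
  obtain ⟨cΓ, hcΓ⟩ : ∃ c : ℝ, c = 1 + 8 * cQ / 3 := ⟨_, rfl⟩
  obtain ⟨cq, hcq⟩ : ∃ c : ℝ, c = 16 * (cη + cQ) ^ 2 / (3 * β) := ⟨_, rfl⟩
  obtain ⟨cE, hcE⟩ : ∃ c : ℝ, c = 4 * (cη + cQ') ^ 2 * (1 + 8 * cQ' / 3) := ⟨_, rfl⟩
  have hcη0 : 0 ≤ cη := by rw [hcη]; positivity
  have hcQ0 : 0 ≤ cQ := by rw [hcQ]; positivity
  have hcQ'0 : 0 ≤ cQ' := by rw [hcQ']; positivity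
  have hcΓ0 : 0 ≤ cΓ := by rw [hcΓ]; positivity
  have hcq0 : 0 ≤ cq := by rw [hcq]; positivity
  have hcE0 : 0 ≤ cE := by rw [hcE]; positivity
  have hcr : (0 : ℝ) < β / 32 := by positivity
  obtain ⟨P₂, hP₂0, hA⟩ := epsA_numerics hcE0 hcΓ0 hcq0 hcr
  obtain ⟨P₃, hP₃0, hBC⟩ := epsBC_numerics_nat hβ hcΓ0 hcq0 hcr
  obtain ⟨P₄, hP₄0, hlit⟩ := typeMargins_smallness_of_scale (β := β) (cε := 2 * K) hβ (by positivity)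
  obtain ⟨P₅, hP₅⟩ : ∃ c : ℝ, c = (8 * K + 36) / β ^ 3 := ⟨_, rfl⟩
  have hP₅0 : 0 ≤ P₅ := by rw [hP₅]; positivity
  refine ⟨2 + P₁ + P₂ + P₃ + P₄ + P₅, by positivity, ?_⟩
  intro n N₀ N₁ N₂ D a s r ε LB hN01 hN12 hr hn hPstar hD1 hD4 haN hnt htn hε0 hεK hLB
  -- the scale
  have hN₀2 : (2 : ℝ) ≤ N₀ := by
    have : 2 ≤ N₀ := by omega
    exact_mod_cast this
  have hN₀1 : (1 : ℝ) ≤ N₀ := by linarith only [hN₀2]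
  obtain ⟨hP1, hP8, hsqrtN, -, hDb⟩ := scale_facts hN₀1
  obtain ⟨P, hP⟩ : ∃ P : ℝ, P = (N₀ : ℝ) ^ ((8 : ℕ) : ℝ)⁻¹ := ⟨_, rfl⟩
  rw [← hP] at hPstar hP1 hP8 hsqrtN hDb
  rw [← hP]
  have hP0 : 0 < P := by linarith only [hP1]
  have hPP₁ : P₁ ≤ P := by linarith only [hPstar, hP₂0, hP₃0, hP₄0, hP₅0]
  have hPP₂ : P₂ ≤ P := by linarith only [hPstar, hP₁0, hP₃0, hP₄0, hP₅0]
  have hPP₃ : P₃ ≤ P := by linarith only [hPstar, hP₁0, hP₂0, hP₄0, hP₅0]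
  have hPP₄ : P₄ ≤ P := by linarith only [hPstar, hP₁0, hP₂0, hP₃0, hP₅0]
  have hPP₅ : P₅ ≤ P := by linarith only [hPstar, hP₁0, hP₂0, hP₃0, hP₄0]
  have hP2 : 2 ≤ P := by linarith only [hPstar, hP₁0, hP₂0, hP₃0, hP₄0, hP₅0]
  have hY256 : (256 : ℝ) ≤ P ^ 8 := by
    have := pow_le_pow_left₀ (by norm_num : (0 : ℝ) ≤ 2) hP2 8
    norm_num at this; exact this
  have hD1r : (1 : ℝ) ≤ D := by exact_mod_cast hD1
  have hD0 : (0 : ℝ) ≤ D := by linarith only [hD1r]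
  have hD : (D : ℝ) ≤ 2 * P ^ 2 := hDb D hD0 hD4
  -- casts of the integer data
  have hN1r : (N₁ : ℝ) = N₀ - 1 := by rw [← hN01]; push_cast; ring
  have hN2r : (N₂ : ℝ) = N₀ - 2 := by rw [← hN01, ← hN12]; push_cast; ring
  have hrr : (r : ℝ) = s - 3 := by rw [← hr]; push_cast; ring
  have hnr : (n : ℝ) = 2 * N₀ := by rw [hn]; push_cast; ring
  have har : (a : ℝ) ≤ N₀ := by exact_mod_cast haN
  have ha0 : (0 : ℝ) ≤ a := Nat.cast_nonneg a
  have hntr : (n : ℝ) ≤ 4 * (2 * s + 1) := by exact_mod_cast hnt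
  have htnr : 2 * (2 * (s : ℝ) + 1) + 2 ≤ n := by exact_mod_cast htn
  have hs_lo : (N₀ : ℝ) / 4 - 1 / 2 ≤ s := by rw [hnr] at hntr; linarith only [hntr]
  have hs_hi : (s : ℝ) ≤ N₀ / 2 - 1 := by rw [hnr] at htnr; linarith only [htnr]
  -- the [BULK] numerics (brick 140c) with `C₁ = 64/β`, `C₂ = 10`, `C₃ = 128`
  obtain ⟨E₀, hE₀⟩ : ∃ e : ℝ, e = 64 / β * (ε + 1 + 10) ^ 2 / (β ^ 4 * ((N₀ : ℝ) - 1)) := ⟨_, rfl⟩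
  obtain ⟨R, hR⟩ : ∃ e : ℝ, e = E₀ + Real.log (2 * 128) + 6 * Real.log N₀ + D := ⟨_, rfl⟩
  obtain ⟨L, hL⟩ : ∃ e : ℝ, e = 2 * D + Real.sqrt (4 * N₀ * R) := ⟨_, rfl⟩
  obtain ⟨b1, b2, b3, b4, b5, b6, b7, b8, b9, b10, b11, b12, b13, b14, b15, b16, b17, b18⟩ :=
    hbulk N₀ (by rw [← hP]; exact hPP₁) hN₀1 D hD1 hD4 ε hε0 hεK E₀ R L hE₀ hR hL
  rw [← hP] at b10 b11 b12
  have hL0 : 0 ≤ L := by linarith only [b2, hD0]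
  -- the three edge numbers in the window of brick 140a
  have hN₀lo : P ^ 8 / 4 ≤ (N₀ : ℝ) - 2 * D := by linarith only [b12]
  have hN₀hi : (N₀ : ℝ) ≤ P ^ 8 := by rw [hP8]
  have hN₁lo : P ^ 8 / 4 ≤ (N₁ : ℝ) - 2 * D := by rw [hN1r]; linarith only [b12]
  have hN₁hi : (N₁ : ℝ) ≤ P ^ 8 := by rw [hN1r, hP8]; linarith only
  have hN₂lo : P ^ 8 / 4 ≤ (N₂ : ℝ) - 2 * D := by rw [hN2r]; exact b12
  have hN₂hi : (N₂ : ℝ) ≤ P ^ 8 := by rw [hN2r, hP8]; linarith only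
  have hPη : 32 * cL / ((β ^ 2 / 8) ^ 4 * β) ≤ P ^ 3 := b11
  obtain ⟨-, -, -, hΓ₀, hq₀0, hq₀⟩ := lqConstants_le hβ hP1 hD0 hD hL0 hcL0 b10 hN₀lo hN₀hi hPη
  obtain ⟨-, -, -, hΓ₁, -, hq₁⟩ := lqConstants_le hβ hP1 hD0 hD hL0 hcL0 b10 hN₁lo hN₁hi hPη
  obtain ⟨-, -, -, hΓ₂, -, hq₂⟩ := lqConstants_le hβ hP1 hD0 hD hL0 hcL0 b10 hN₂lo hN₂hi hPη
  rw [← hcQ] at hΓ₀ hΓ₁ hΓ₂ hq₀ hq₁ hq₂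
  rw [← hcη] at hq₀ hq₁ hq₂
  rw [← hcΓ] at hΓ₀ hΓ₁ hΓ₂
  rw [← hcq] at hq₀ hq₁ hq₂
  -- the level-1 x-smoothness constant
  have hL2 : L + 2 ≤ cL * P ^ 5 := by linarith only [b10, hD1r]
  have hN₀2lo : P ^ 8 / 4 ≤ (N₀ : ℝ) - 2 := by linarith only [b12, hD0]
  have hN₀2hi : (N₀ : ℝ) - 2 ≤ P ^ 8 := by rw [hP8]; linarith only
  have hEle := xSmoothConst_le hβ hP1 hL0 hcL0 hL2 hN₀2lo hN₀2hi hPη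
  rw [← hcη, ← hcQ', ← hcE] at hEle
  -- the far terms
  obtain ⟨τ, hτ⟩ : ∃ e : ℝ, e = Real.exp (-((L - 2 * D) ^ 2 / (4 * N₀))) := ⟨_, rfl⟩
  have hτ0 : 0 ≤ τ := by rw [hτ]; exact (Real.exp_pos _).le
  have hLBpos : 0 < LB := lt_of_lt_of_le (by positivity) hLB
  have hN₀pos : (0 : ℝ) < N₀ := by linarith only [hN₀1]
  have hE₀ge : 64 * (ε + 11) ^ 2 / (β ^ 5 * (N₀ : ℝ)) ≤ E₀ := by
    rw [hE₀, div_le_div_iff₀ (mul_pos (pow_pos hβ 5) hN₀pos) (mul_pos (pow_pos hβ 4) (by linarith only [hN₀2]))]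
    have e : ε + 1 + 10 = ε + 11 := by ring
    rw [e]
    have h1 : 0 ≤ 64 * (ε + 11) ^ 2 := by positivity
    have h2 : β ^ 4 * ((N₀ : ℝ) - 1) ≤ β ^ 4 * N₀ := mul_le_mul_of_nonneg_left (by linarith only) (pow_pos hβ 4).le
    calc 64 * (ε + 11) ^ 2 * (β ^ 4 * ((N₀ : ℝ) - 1)) ≤ 64 * (ε + 11) ^ 2 * (β ^ 4 * N₀) := mul_le_mul_of_nonneg_left h2 h1
      _ = 64 / β * (ε + 11) ^ 2 * (β ^ 5 * N₀) := by field_simp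
  have hLB' : Real.exp (-E₀) / (128 * (N₀ : ℝ) ^ 2) ≤ LB := by
    refine le_trans ?_ hLB
    exact div_le_div_of_nonneg_right (Real.exp_le_exp.2 (by linarith only [hE₀ge])) (by positivity)
  have hP32 : (N₀ : ℝ) ^ 4 = P ^ 32 := by rw [← hP8]; ring
  have hDτ : (D : ℝ) * (4 / 3 : ℝ) ^ D * τ ≤ LB / (2 * P ^ 32) := by
    rw [hτ, ← hP32]
    exact b9.trans (div_le_div_of_nonneg_right hLB' (by positivity))
  have hτ1 : τ ≤ (D : ℝ) * (4 / 3 : ℝ) ^ D * τ := by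
    have h1 : (1 : ℝ) ≤ (D : ℝ) * (4 / 3 : ℝ) ^ D := by
      have : (1 : ℝ) ≤ (4 / 3 : ℝ) ^ D := one_le_pow₀ (by norm_num)
      nlinarith only [hD1r, this]
    nlinarith only [h1, hτ0]
  have hτle : τ ≤ LB / (2 * P ^ 32) := hτ1.trans hDτ
  have hDτ9 : (D : ℝ) * (4 / 3 : ℝ) ^ D * τ ≤ LB / (2 * P ^ 9) := by
    refine hDτ.trans (div_le_div_of_nonneg_left hLBpos.le (by positivity) ?_)
    have : P ^ 9 ≤ P ^ 32 := pow_le_pow_right₀ hP1 (by norm_num)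
    linarith only [this]
  obtain ⟨Far, hFar⟩ : ∃ e : ℝ, e = 4 * Real.exp (-((L - 2) ^ 2 / (4 * ((N₀ : ℝ) - 2)))) := ⟨_, rfl⟩
  have hFar0 : 0 ≤ Far := by rw [hFar]; positivity
  have hFarτ : Far ≤ 4 * τ := by
    rw [hFar, hτ]
    refine mul_le_mul_of_nonneg_left (Real.exp_le_exp.2 ?_) (by norm_num)
    rw [neg_le_neg_iff]
    have hN₀pos : (0 : ℝ) < N₀ := by linarith only [hN₀1]
    have hN₀2pos : (0 : ℝ) < (N₀ : ℝ) - 2 := by linarith only [hN₀2lo, hY256]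
    rw [div_le_div_iff₀ (by linarith only [hN₀pos]) (by linarith only [hN₀2pos])]
    have h1 : (L - 2 * D) ^ 2 ≤ (L - 2) ^ 2 := by nlinarith only [b2, hD1r]
    have h2 : 0 ≤ (L - 2) ^ 2 := sq_nonneg _
    exact mul_le_mul h1 (by linarith only) (by linarith only [hN₀2pos]) h2
  -- the variance floor
  obtain ⟨cV, hcV⟩ : ∃ e : ℝ, e = (Real.sqrt 2 * (β / 32) * P ^ 4) ^ 2 / 2 := ⟨_, rfl⟩
  have hsqcV : Real.sqrt cV = β / 32 * P ^ 4 := by rw [hcV]; exact sqrt_half_sq_radius P hcr.le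
  have hcVeq' : cV = (β / 32) ^ 2 * P ^ 8 := by
    rw [hcV]
    have hs2 : Real.sqrt 2 ^ 2 = 2 := Real.sq_sqrt (by norm_num)
    rw [mul_pow, mul_pow, hs2]; ring
  have hcVpos : 0 < cV := by rw [hcVeq']; positivity
  have hcrV : (β / 32) ^ 2 * P ^ 8 ≤ cV := le_of_eq hcVeq'.symm
  -- the cut
  have hs0 : (0 : ℝ) ≤ s := Nat.cast_nonneg s
  have hr0 : (0 : ℝ) ≤ r := Nat.cast_nonneg r
  have hN₀256 : (256 : ℝ) ≤ N₀ := hP8 ▸ hY256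
  have h2r6 : P ^ 8 / 4 ≤ 2 * (r : ℝ) + 6 := by rw [hrr, hP8]; linarith only [hs_lo, hN₀256]
  have hr58 : 8 * ((r : ℝ) + 2) ≤ 5 * P ^ 8 := by rw [hrr, hP8]; linarith only [hs_hi, hN₀1]
  have hsβ : β * P ^ 8 ≤ s := by rw [hP8]; linarith only [b13, hs_lo, hD0]
  have hsP : (s : ℝ) ≤ P ^ 8 := by rw [hP8]; linarith only [hs_hi, hN₀1]
  have hnP : (n : ℝ) = 2 * P ^ 8 := by rw [hnr, hP8]
  have haP : (a : ℝ) ≤ P ^ 8 := by rw [hP8]; exact har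
  -- ε in the scale
  have hεb : ε ≤ 2 * K * P ^ 5 := by
    refine hεK.trans ?_
    have hs : Real.sqrt (2 * N₀ * D) ≤ 2 * P ^ 5 := by
      rw [show (2 : ℝ) * P ^ 5 = Real.sqrt ((2 * P ^ 5) ^ 2) by rw [Real.sqrt_sq (by positivity)]]
      refine Real.sqrt_le_sqrt ?_
      rw [← hP8]
      have : 2 * P ^ 8 * (D : ℝ) ≤ 2 * P ^ 8 * (2 * P ^ 2) := mul_le_mul_of_nonneg_left hD (by positivity)
      nlinarith only [this]
    have := mul_le_mul_of_nonneg_left hs hK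
    linarith only [this]
  -- assemble
  have hcΓP : 0 ≤ cΓ * P := by positivity
  have hcqP : 0 ≤ cq / P ^ 6 := by positivity
  have hεA := hA P hPP₂ hP1 D (cE / P ^ 5) (cΓ * P) (cq / P ^ 6) (a : ℝ) (r : ℝ) (n : ℝ) cV LB τ Far hD1 hD le_rfl hcΓP le_rfl
    hcqP le_rfl ha0 haP hr0 h2r6 hr58 hnP hcrV hLBpos hτ0 hτle hDτ hFar0 hFarτ
  have hεBC := fun (m : ℝ) (hm0 : 0 ≤ m) (hma : m ≤ (a : ℝ)) =>
    hBC P hPP₃ hP1 D (cΓ * P) (cΓ * P) (cq / P ^ 6) (cq / P ^ 6) m (s : ℝ) (n : ℝ) (a : ℝ) LB τ τ (Real.sqrt cV)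
      hcΓP le_rfl hcΓP le_rfl hcqP le_rfl hcqP le_rfl hm0 (hma.trans haP) hsβ hsP hnP hD ha0 haP
      hLBpos hτ0 le_rfl hDτ9 (le_of_eq hsqcV.symm)
  have hqh : cq / P ^ 6 ≤ 1 / 2 := (hεBC 0 le_rfl ha0).2.2.1
  have hε7 : ε ≤ 2 * K * P ^ 7 :=
    hεb.trans (mul_le_mul_of_nonneg_left (pow_le_pow_right₀ hP1 (by norm_num)) (by positivity))
  have hlit' := hlit P hPP₄ hP1 ε hε0 hε7
  rw [hP8] at hlit'
  have hLBsmall : 4 * ε + 36 ≤ β ^ 3 * N₀ := by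
    rw [← hP8]
    have h1 : (8 * K + 36) / β ^ 3 ≤ P := by rw [← hP₅]; exact hPP₅
    rw [div_le_iff₀ (by positivity)] at h1
    have hP5 : (1 : ℝ) ≤ P ^ 5 := one_le_pow₀ hP1
    have hP86 : P * P ^ 5 ≤ P ^ 8 := by
      have : P ^ 6 ≤ P ^ 8 := pow_le_pow_right₀ hP1 (by norm_num)
      nlinarith only [this]
    have h2 : (8 * K + 36) * P ^ 5 ≤ β ^ 3 * (P * P ^ 5) := by nlinarith only [h1, hP5, pow_pos hβ 3]
    nlinarith only [h2, hP86, hεb, hP5, hK, pow_pos hβ 3]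
  refine ⟨L, cE / P ^ 5, Far, cΓ * P, cq / P ^ 6, cV, ?_, b2, ?_, ?_, ?_, ?_, ?_, ?_, ?_, ?_, ?_, ?_, ?_, ?_, ?_, by positivity, hFar0, hEle, ?_,
    hΓ₀, hΓ₁, hΓ₂, hq₀, hq₁, hq₂, hqh, hcVpos, ?_, ?_, ?_, ?_, ?_, ?_, by rw [hcV], hlit', hLBsmall⟩
  · -- hDN
    have : (16 : ℝ) * D + 16 ≤ N₂ := by rw [hN2r]; exact b1
    exact_mod_cast this
  · rw [hN2r]; exact b3
  · rw [hN2r]; exact b4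
  · rw [hN2r]; exact b5
  · rw [hN2r]; exact b6
  · rw [hN2r]; exact b7
  · rw [hN2r]; exact b8
  · linarith only [b2, hD1r]
  · linarith only [b3, hD0, hN₀2]
  · -- hLx1 : L + 1 + (ε + 15) ≤ β (r + 2)
    rw [hrr]
    have h1 : β * (β * N₀) ≤ β * ((s : ℝ) - 1) := by
      refine mul_le_mul_of_nonneg_left ?_ hβ.le
      rw [← hP8] at b13 ⊢; linarith only [b13, hs_lo, hD0, hP8]
    have h2 : β ^ 2 * ((N₀ : ℝ) - 2) ≤ β ^ 2 * N₀ := by nlinarith only [pow_pos hβ 2]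
    have h3 : β * (β * (N₀ : ℝ)) = β ^ 2 * N₀ := by ring
    linarith only [b4, h1, h2, h3, hD1r, hD0]
  · linarith only [b5, hD0, hD1r, mul_nonneg hβ.le hD0]
  · have h1 : (β ^ 2 / 8) ^ 2 * (β * (((N₀ : ℝ) - 2) - 2 * D)) ≤ (β ^ 2 / 8) ^ 2 * (β * ((N₀ : ℝ) - 2)) := by
      have : β * (((N₀ : ℝ) - 2) - 2 * D) ≤ β * ((N₀ : ℝ) - 2) := by nlinarith only [hβ, hD0]
      exact mul_le_mul_of_nonneg_left this (by positivity)
    linarith only [b6, h1, hD1r]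
  · have : β * (((N₀ : ℝ) - 2) - 2 * D) ≤ β * ((N₀ : ℝ) - 2) := by nlinarith only [hβ, hD0]
    linarith only [b7, this]
  · -- hkV from hq5
    have hden₂ : 0 < (β ^ 2 / 8) ^ 4 * (β * (((N₀ : ℝ) - 2) - 2 * D)) := by
      have : 0 < ((N₀ : ℝ) - 2) - 2 * D := lt_of_lt_of_le (by positivity) b12
      positivity
    have hden₀ : (β ^ 2 / 8) ^ 4 * (β * (((N₀ : ℝ) - 2) - 2 * D)) ≤ (β ^ 2 / 8) ^ 4 * (β * ((N₀ : ℝ) - 2)) := by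
      have : β * (((N₀ : ℝ) - 2) - 2 * D) ≤ β * ((N₀ : ℝ) - 2) := by nlinarith only [hβ, hD0]
      exact mul_le_mul_of_nonneg_left this (by positivity)
    have h1 : 8 * (L + 1 + 1) / ((β ^ 2 / 8) ^ 4 * (β * ((N₀ : ℝ) - 2))) ≤
        8 * (L + D + 1) / ((β ^ 2 / 8) ^ 4 * (β * (((N₀ : ℝ) - 2) - 2 * D))) := by
      calc 8 * (L + 1 + 1) / ((β ^ 2 / 8) ^ 4 * (β * ((N₀ : ℝ) - 2)))
          ≤ 8 * (L + D + 1) / ((β ^ 2 / 8) ^ 4 * (β * ((N₀ : ℝ) - 2))) :=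
            div_le_div_of_nonneg_right (by linarith only [hD1r]) (hden₂.le.trans hden₀)
        _ ≤ 8 * (L + D + 1) / ((β ^ 2 / 8) ^ 4 * (β * (((N₀ : ℝ) - 2) - 2 * D))) :=
            div_le_div_of_nonneg_left (by linarith only [hL0, hD0]) hden₂ hden₀
    have h2 : (1 : ℝ) * (1 + 8 * (L + D + 1) / ((β ^ 2 / 8) ^ 4 * (β * (((N₀ : ℝ) - 2) - 2 * D)))) ≤
        (D : ℝ) * (1 + 8 * (L + D + 1) / ((β ^ 2 / 8) ^ 4 * (β * (((N₀ : ℝ) - 2) - 2 * D)))) :=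
      mul_le_mul_of_nonneg_right hD1r (by positivity)
    linarith only [h1, h2, b8, hden₀]
  · -- hFar
    rw [hFar]; norm_num
  · -- hεA ≤ 3/4 (from ≤ 1/2)
    rw [hτ] at hεA
    exact hεA.trans (by norm_num)
  · -- hεB
    intro m hm0 hma
    have h := (hεBC m hm0 hma).1
    rw [hτ] at h
    exact h
  · have h := (hεBC 0 le_rfl ha0).2.1
    rw [hτ] at h
    exact h
  · -- β N₂ + D + 2 ≤ s
    rw [hN2r]
    linarith only [b13, hs_lo, hβ.le, hD0]
  · linarith only [b14, hs_hi, hβ]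
  · rw [hnr]
    linarith only [hs_hi, b1, hD0]

end Summit.PneNP.PneNP.Theorems.ChebyshevTracialDesignGammaDirectionNumericsAll

end
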